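import Summits.QuantumFields.YangMills.Theorems.AlphaInputsT3ACDeepFibrePointOfRows
import Summits.QuantumFields.YangMills.Theorems.AlphaInputsT3ACChargeOfDeepFibrePoint
import HarnessLib

/-!
# `AlphaInputsT3ACDeepFibrePointSizeRows` — THE SIZE ROWS OF THE DEEP FIBRE POINT DISCHARGED AT PRINT'S CONSTANT `c = 1` (cell `ym3-torus`, row #23 `fibre57LowOn` residue `hcharge`,
# link (L1) of the `hcharge` chain; seat `ym3-torus-px20` g13, width copy of p1; sequel of ✓`AlphaInputsT3ACDeepFibrePointOfRows`; `--supports stmt-QuantumFields-19936 --as helper`)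

WHAT.  ✓`AlphaInputsT3AC.PkgCoreRows.deepFibrePoint_of_rows` displays four γ∕L size rows on `α₀ := c·ε₁(k+1)·L⁻²`.  At print's constant `c = 1` ([Balaban1985UV3] (47) p.267, family `loPrintAC`)
and loop radius `α := ε_P = (10·|Idx (F.P K)|)⁻¹ = (360L³)⁻¹` (the chart radius of the T³ lower row), ALL FOUR follow from the size window `hγs : γ ≤ ((((4500·L⁵)⁻¹ ∕ (b₀Q₀(p₀)))²)²` that every T³ lower-row
theorem already displays (✓`fibre57LowOnAC_T3_of_le_gamma` and its editions) and `L ≥ 2`, `k + 1 ≤ K` — `PinnedStepTrivPins.sizeRows_one_of_le_gamma` (γ∕L arithmetic: `ε₁ ≤ (4500L⁵)⁻¹`, `δ₂ = ⅓`,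
`ε₁(k+1) ≤ √L·ε₁(k)`, the size line at level `k+1`).  Hence ★★★ `AlphaInputsT3AC.PkgCoreRows.hdeepLoops_loPrintAC_of_le_gamma`: on the size window, every `V ∈ loPrintAC 𝔠.lane q.X (k+1)` has a one-step
fibre point `U₀` with all loops `< ε_P` and `χB_k(triv′)(U₀) ≠ 0` — the `hdeep` letter of ✓`AvgFunLocalLowerDensity.charge_of_deepFibrePoints` (w8-19936 g16, ✓p775703) at `L := loPrintAC (k+1)`, `ε := ε_P`, with NO
size row left.  (The (E1) family `c = max B₃ 1` keeps its floor `2·max(B₃,1)·ε₁(k+1)L⁻² < ε₁(k)` — not discharged here.)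

HONEST SCOPE.  [folklore] arithmetic over landed theorems; def-free; nothing of (37)∕(47)∕(57), of row #23, of `hcharge`, of the (α) data rows (0∕23), of (O‴χₛ), `HistoryTailL` (19936), EX, LOWB∘ or
`YM3TorusSU2` is proved (rung R3 = SU(2) YM₃ on T³, a RECORD rung: NOT d = 4, NOT infinite volume, NOT a mass gap, NOT Clay; the Yang–Mills mass gap is NOT proved).  L-floor: none beyond the
family's `1 < L`.
References: T. Bałaban, Commun. Math. Phys. **102** (1985) 255–275 [Balaban1985UV3] ((3) p.256, (7) p.257, (47) p.267); Commun. Math. Phys. **98** (1985) 17–51 [Balaban1985Averaging] (Prop. 2 p.26);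
Commun. Math. Phys. **109** (1987) 249–301 [Balaban1987RG1] ((0.4) p.253).
-/

set_option autoImplicit false

noncomputable section

namespace Summit.QuantumFields.YangMills.Theorems

open MeasureTheory Literature.MathematicalPhysics.QuantumFieldTheory.Balaban1983to89
open Literature.MathematicalPhysics.QuantumFieldTheory.Balaban1983to89.GaugeField (GaugeInvariant gaugeAct)
open Literature.MathematicalPhysics.QuantumFieldTheory.Balaban1983to89.BlockAveraging (avgFun loopHol Idx blockAvg)
open Literature.MathematicalPhysics.QuantumFieldTheory.Balaban1983to89.ExpMeanLog (expMeanLogSU deltaSU)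
open Literature.MathematicalPhysics.QuantumFieldTheory.Balaban1983to89.T3ContinuumYM3Torus
open Literature.MathematicalPhysics.QuantumFieldTheory.Balaban1983to89.T3UnitScaleTilt (θBal)
open Literature.MathematicalPhysics.QuantumFieldTheory.Balaban1985CMP102 Literature.MathematicalPhysics.QuantumFieldTheory.Balaban1985CMP102.Setting
open Summit.QuantumFields.Balaban3D.Carriers
open Summit.QuantumFields.Balaban3D.Proofs.Primitives
open Summit.QuantumFields.Balaban3D.Proofs.Thresholds (Q0 Q0_pos)
open Summit.QuantumFields.Balaban3D.Proofs.TowerAC Summit.QuantumFields.Balaban3D.Proofs.StandardAC Summit.QuantumFields.Balaban3D.Proofs.InputsAC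
open Summit.QuantumFields.Balaban3D.Proofs.Bound55Masses (chiB)
open Summit.QuantumFields.Balaban3D.Proofs.GaussianNormalization (partZ normalized)
open Summit.QuantumFields.YangMills.Theorems.PinnedStep (Fibre57LowOnAC)
open scoped NNReal ENNReal

namespace PinnedStepTrivPins

variable {F : T3Family} {𝔠 : AlphaConsts F.L (suGroupModel 2).N}

/-! ## §1 The size bound of the thresholds on the size window -/

/-- On the size window `γ ≤ ((((4500·L⁵)⁻¹ ∕ (b₀Q₀(p₀)))²)²` every threshold of the run is below `(4500·L⁵)⁻¹`: `ε₁(j) ≤ (4500L⁵)⁻¹` for `j ≤ K`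
(`eps1Of_T3Scales_eq_of_le_one` + lit ✓`T3Thresholds.θBal_le_of_le_gamma`). [cite: Balaban1985UV3, (7) p.257] -/
theorem eps1Of_le_sizeBound_of_le_gamma (γ : ℝ) (hγ : 0 < γ) (hγ1 : γ ≤ 1)
    (hγs : γ ≤ ((((4500 : ℝ) * (F.L : ℝ) ^ 5)⁻¹ / (𝔠.b₀ * Q0 𝔠.p₀)) ^ 2) ^ 2) (K j : ℕ) (hj : j ≤ K) :
    eps1Of (T3Scales F γ hγ hγ1 K) 𝔠.lane.carrier j ≤ ((4500 : ℝ) * (F.L : ℝ) ^ 5)⁻¹ := by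
  have hL1 : 1 ≤ F.L := le_of_lt F.hL.2
  rw [eps1Of_T3Scales_eq_of_le_one (𝔠 := 𝔠) γ hγ hγ1 K j hj]
  exact T3Thresholds.θBal_le_of_le_gamma hL1 𝔠.b₀_pos 𝔠.p₀_pos (by positivity) hγ hγ1 hγs (K - j)

/-! ## §2 The four size rows of the deep fibre point at `c = 1` -/

/-- ★★ **THE FOUR SIZE ROWS OF `deepFibrePoint_of_rows` AT `c = 1` HOLD ON THE SIZE WINDOW, EVERY `L ≥ 2`, EVERY `k + 1 ≤ K`** — (P3) `143·((d+4)²∕4)²·(ε₁(k+1)·L⁻²) ≤ ⅓`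
and (P2) `2ε₁(k+1)L⁻² ≤ 2δ₂∕((d+4)L)²` from `ε₁(k+1) ≤ (4500L⁵)⁻¹ ≤ 1∕144000`, `L⁻² ≤ ¼`, `δ₂ = ⅓`; (win) `2ε₁(k+1)L⁻² < ε₁(k)` from `ε₁(k+1) ≤ √L·ε₁(k)`
(✓`T3SmallLiftHistory.sqrt_inv_mul_θBal_le_succ`) and `2√L < L²`; (loop) `((d+2)L)²∕4·2ε₁(k+1)L⁻² < ε_P` from the size line ✓`sizeLine_T3_of_le_gamma` at level `k+1` and `2L⁻² ≤ 1`.  Pure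
γ∕L arithmetic; the rows are the exact binder texts of ✓`AlphaInputsT3AC.PkgCoreRows.deepFibrePoint_of_rows` at `c = 1`, `α = ε_P`. [cite: Balaban1985UV3, (3) p.256 and (7) p.257] -/
theorem sizeRows_one_of_le_gamma (γ : ℝ) (hγ : 0 < γ) (hγ1 : γ ≤ 1)
    (hγs : γ ≤ ((((4500 : ℝ) * (F.L : ℝ) ^ 5)⁻¹ / (𝔠.b₀ * Q0 𝔠.p₀)) ^ 2) ^ 2) (K k : ℕ) (hk : k + 1 ≤ K) :
    (143 * (((((F.P K).d + 4 : ℕ) : ℝ)) ^ 2 / 4) ^ 2) *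
        (1 * eps1Of (T3Scales F γ hγ hγ1 K) 𝔠.lane.carrier (k + 1) * ((F.L : ℝ)⁻¹) ^ 2) ≤ 1 / 3 ∧
      2 * (1 * eps1Of (T3Scales F γ hγ hγ1 K) 𝔠.lane.carrier (k + 1) * ((F.L : ℝ)⁻¹) ^ 2) ≤
        2 * deltaSU (Fin 2) / ((((F.P K).d + 4) * (F.P K).L : ℕ) : ℝ) ^ 2 ∧
      2 * (1 * eps1Of (T3Scales F γ hγ hγ1 K) 𝔠.lane.carrier (k + 1) * ((F.L : ℝ)⁻¹) ^ 2) <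
        eps1Of (T3Scales F γ hγ hγ1 K) 𝔠.lane.carrier k ∧
      ((((F.P K).d + 2) * (F.P K).L : ℕ) : ℝ) ^ 2 / 4 *
        (2 * (1 * eps1Of (T3Scales F γ hγ hγ1 K) 𝔠.lane.carrier (k + 1) * ((F.L : ℝ)⁻¹) ^ 2)) <
        ((Fintype.card (Idx (F.P K)) : ℝ))⁻¹ / 10 := by
  have hL1 : 1 ≤ F.L := le_of_lt F.hL.2
  have hL2n : 2 ≤ F.L := F.hL.2
  have hL2 : (2 : ℝ) ≤ F.L := by exact_mod_cast hL2n
  have hLpos : (0 : ℝ) < F.L := by linarith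
  set ε1 : ℝ := eps1Of (T3Scales F γ hγ hγ1 K) 𝔠.lane.carrier (k + 1) with hε1
  set ε0 : ℝ := eps1Of (T3Scales F γ hγ hγ1 K) 𝔠.lane.carrier k with hε0
  have hε1le : ε1 ≤ ((4500 : ℝ) * (F.L : ℝ) ^ 5)⁻¹ := eps1Of_le_sizeBound_of_le_gamma γ hγ hγ1 hγs K (k + 1) hk
  have hε1pos : 0 < ε1 := PinnedStep.eps1Of_carrier_pos (S := T3Scales F γ hγ hγ1 K) 𝔠.lane (k + 1) hk
  have hε0pos : 0 < ε0 := PinnedStep.eps1Of_carrier_pos (S := T3Scales F γ hγ hγ1 K) 𝔠.lane k (k.le_succ.trans hk)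
  -- numerics of the T³ record: `d = 3`, `(F.P K).L = F.L`
  have hd : (F.P K).d = 3 := rfl
  have hPL : (F.P K).L = F.L := rfl
  -- `ε₁(k+1) ≤ 1/144000`
  have hL5 : (32 : ℝ) ≤ (F.L : ℝ) ^ 5 := by
    calc (32 : ℝ) = 2 ^ 5 := by norm_num
      _ ≤ (F.L : ℝ) ^ 5 := by gcongr
  have hβ : ((4500 : ℝ) * (F.L : ℝ) ^ 5)⁻¹ ≤ 1 / 144000 := by
    rw [one_div]; exact inv_anti₀ (by norm_num) (by nlinarith)
  have hε1s : ε1 ≤ 1 / 144000 := hε1le.trans hβ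
  have hLinv : ((F.L : ℝ)⁻¹) ^ 2 ≤ 1 / 4 := by
    have : ((F.L : ℝ)⁻¹) ≤ 1 / 2 := by rw [one_div]; exact inv_anti₀ two_pos hL2
    have h0 : 0 ≤ ((F.L : ℝ)⁻¹) := inv_nonneg.2 hLpos.le
    nlinarith
  have hLinv0 : 0 ≤ ((F.L : ℝ)⁻¹) ^ 2 := by positivity
  have hx : ε1 * ((F.L : ℝ)⁻¹) ^ 2 ≤ 1 / 144000 * (1 / 4) :=
    mul_le_mul hε1s hLinv hLinv0 (by norm_num)
  refine ⟨?_, ?_, ?_, ?_⟩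
  · -- (P3)
    rw [hd]; push_cast
    nlinarith [hx, mul_nonneg hε1pos.le hLinv0]
  · -- (P2): `2δ₂/(7L)² = 2/(147 L²)` and `ε₁ ≤ 1/147`
    -- `δ_{SU(2)} = min (1∕3) (π∕2) = 1∕3` ([Balaban1987RG1] (0.4) p.253; cf. ✓`AvgActionDefect.deltaSU_fin_two`, ✓`chartRadius_T3_lt_deltaSU2`)
    have hδ : deltaSU (Fin 2) = 1 / 3 := by
      unfold deltaSU
      rw [Fintype.card_fin]
      refine min_eq_left ?_
      have := Real.pi_gt_three
      push_cast
      linarith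
    rw [hd, hPL, hδ]; push_cast
    rw [show ((7 : ℝ) * (F.L : ℝ)) ^ 2 = 49 * (F.L : ℝ) ^ 2 by ring, div_eq_mul_inv, mul_inv]
    have hinv0 : 0 ≤ ((F.L : ℝ) ^ 2)⁻¹ := by positivity
    have hpow : ((F.L : ℝ)⁻¹) ^ 2 = ((F.L : ℝ) ^ 2)⁻¹ := inv_pow _ _
    rw [hpow]
    nlinarith [mul_le_mul_of_nonneg_right hε1s hinv0]
  · -- (win): `ε₁(k+1) ≤ √L·ε₁(k)` and `2√L < L²`
    have heq1 : ε1 = θBal F.L γ 𝔠.b₀ 𝔠.p₀ (K - (k + 1)) := by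
      rw [hε1]; exact eps1Of_T3Scales_eq_of_le_one (𝔠 := 𝔠) γ hγ hγ1 K (k + 1) hk
    have heq0 : ε0 = θBal F.L γ 𝔠.b₀ 𝔠.p₀ (K - k) := by
      rw [hε0]; exact eps1Of_T3Scales_eq_of_le_one (𝔠 := 𝔠) γ hγ hγ1 K k (by omega)
    have hstep := T3SmallLiftHistory.sqrt_inv_mul_θBal_le_succ (L := F.L) (γ := γ) (b₀ := 𝔠.b₀) (p₀ := 𝔠.p₀)
      hL1 hγ hγ1 𝔠.b₀_pos.le 𝔠.p₀_pos.le (K - (k + 1))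
    rw [show K - (k + 1) + 1 = K - k by omega, ← heq1, ← heq0] at hstep
    -- `hstep : √(L⁻¹)·ε1 ≤ ε0`; and `2·L⁻² < √(L⁻¹)` since `2√L < L²`
    have hsq : Real.sqrt ((F.L : ℝ)⁻¹) = (Real.sqrt (F.L : ℝ))⁻¹ := Real.sqrt_inv _
    have hsqrtpos : 0 < Real.sqrt (F.L : ℝ) := Real.sqrt_pos.2 hLpos
    have hsqrt_lt : Real.sqrt (F.L : ℝ) < F.L := by
      rw [Real.sqrt_lt' hLpos]; nlinarith
    have key : 2 * Real.sqrt (F.L : ℝ) < (F.L : ℝ) ^ 2 := by nlinarith [hsqrt_lt, hL2, hsqrtpos]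
    have h2lt : 2 * ((F.L : ℝ)⁻¹) ^ 2 < Real.sqrt ((F.L : ℝ)⁻¹) := by
      have h' : (2 : ℝ) / (F.L : ℝ) ^ 2 < 1 / Real.sqrt (F.L : ℝ) := by
        rw [div_lt_div_iff₀ (by positivity) hsqrtpos]; linarith [key]
      rw [hsq, inv_pow]
      rw [div_eq_mul_inv, one_div] at h'
      exact h'
    calc 2 * (1 * ε1 * ((F.L : ℝ)⁻¹) ^ 2) = (2 * ((F.L : ℝ)⁻¹) ^ 2) * ε1 := by ring
      _ < Real.sqrt ((F.L : ℝ)⁻¹) * ε1 := mul_lt_mul_of_pos_right h2lt hε1pos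
      _ ≤ ε0 := hstep
  · -- (loop): from the size line at level `k+1` and `2·L⁻² ≤ 1`
    have hsize := sizeLine_T3_of_le_gamma (𝔠 := 𝔠) γ hγ hγ1 hγs K (k + 1) hk
    have hc0 : 0 ≤ ((((F.P K).d + 2) * (F.P K).L : ℕ) : ℝ) ^ 2 / 4 := by positivity
    have h2L : 2 * ((F.L : ℝ)⁻¹) ^ 2 ≤ 1 := by nlinarith [hLinv]
    calc ((((F.P K).d + 2) * (F.P K).L : ℕ) : ℝ) ^ 2 / 4 * (2 * (1 * ε1 * ((F.L : ℝ)⁻¹) ^ 2))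
        = ((((F.P K).d + 2) * (F.P K).L : ℕ) : ℝ) ^ 2 / 4 * ε1 * (2 * ((F.L : ℝ)⁻¹) ^ 2) := by ring
      _ ≤ ((((F.P K).d + 2) * (F.P K).L : ℕ) : ℝ) ^ 2 / 4 * ε1 * 1 :=
          mul_le_mul_of_nonneg_left h2L (mul_nonneg hc0 hε1pos.le)
      _ = ((((F.P K).d + 2) * (F.P K).L : ℕ) : ℝ) ^ 2 / 4 * ε1 := mul_one _
      _ < ((Fintype.card (Idx (F.P K)) : ℝ))⁻¹ / 10 := hsize.2

end PinnedStepTrivPins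

namespace AlphaInputsT3AC.PkgCoreRows

variable {F : T3Family} {𝔠 : AlphaConsts F.L (suGroupModel 2).N} {γ : ℝ} {hγ : 0 < γ} {hγ1 : γ ≤ (min 𝔠.gamma0 1) ^ 2} {K : ℕ}
  (q : AlphaInputsT3AC.PkgCoreRows F 𝔠 γ hγ hγ1 K)

/-! ## §3 The deep-fibre-point letters on print's family `loPrintAC`, size rows discharged -/

/-- ★★★ **THE DEEP-FIBRE-POINT LETTER `hdeep` ON PRINT'S FAMILY, NO SIZE ROW LEFT**: on the size window, for every `k + 1 ≤ K`, every `V ∈ loPrintAC 𝔠.lane q.X (k+1)` is `Ū(U₀)` for some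
level-`k` field `U₀` with `χB_k(triv′)(U₀) ≠ 0` — EXACTLY the binder `hdeep` of ✓`PinnedStepTrivPins.hcharge_of_deepFibrePoints` ∕ ✓`fibre57LowOnAC_T3_of_le_gamma_of_deepFibrePoints`
(w8-19936 g16, ✓`…AlphaInputsT3ACChargeOfDeepFibrePoint`) at `lo := PinnedStep.loPrintAC 𝔠.lane q.X`; = ✓`hdeep_loPrintAC_of_rows` ∘ `sizeRows_one_of_le_gamma`.  Print's reason for the χ on
the minimiser ((47) p.267): the χ^min point `(blockAvg ℰp)^k(U_k(V))` of the fibre over `V`. [cite: Balaban1985UV3, (47) p.267 + (42) p.266; Balaban1985Averaging, Prop. 2 (52)–(54) p.26] -/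
theorem hdeep_loPrintAC_of_le_gamma (hγs : γ ≤ ((((4500 : ℝ) * (F.L : ℝ) ^ 5)⁻¹ / (𝔠.b₀ * Q0 𝔠.p₀)) ^ 2) ^ 2) (k : ℕ) (hk : k + 1 ≤ K) :
    ∀ V ∈ PinnedStep.loPrintAC 𝔠.lane q.X (k + 1),
      ∃ U₀ : GaugeField (F.P K) k (Matrix.specialUnitaryGroup (Fin 2) ℂ), avgFun (expMeanLogSU (n := Fin 2)) U₀ = V ∧
        chiB 𝔠.lane.carrier.M₁ (rcolOf (T3Scales F γ hγ (hγ1.trans (sq_min_one_le _ 𝔠.gamma0_pos)) K) 𝔠.lane.carrier) (eps1Of (T3Scales F γ hγ (hγ1.trans (sq_min_one_le _ 𝔠.gamma0_pos)) K) 𝔠.lane.carrier) k (Hist.triv (F.P K) (k + 1)) U₀ ≠ 0 := by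
  obtain ⟨hP3, hP2, hwin, -⟩ := PinnedStepTrivPins.sizeRows_one_of_le_gamma (𝔠 := 𝔠) γ hγ
    (hγ1.trans (sq_min_one_le _ 𝔠.gamma0_pos)) hγs K k hk
  exact q.hdeep_loPrintAC_of_rows k hk hP3 hP2 hwin

/-- ★★★ **THE DEEP FIBRE POINT ON PRINT'S FAMILY WITH THE SIZE ROWS DISCHARGED**: on the size window `γ ≤ ((((4500·L⁵)⁻¹ ∕ (b₀Q₀(p₀)))²)²` (the `hγs` every T³ lower-row
theorem already displays), for every `k + 1 ≤ K` and every `V ∈ loPrintAC 𝔠.lane q.X (k+1)` there is `U₀` with `avgFun ℰp U₀ = V`, ALL (0.4) loop variables within the chart radius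
`ε_P = (10·|Idx|)⁻¹ = (360L³)⁻¹` of `1`, and `χB_k(triv′)(U₀) ≠ 0` — `deepFibrePoint_of_rows` at `c = 1` ∘ `PinnedStepTrivPins.sizeRows_one_of_le_gamma`.  This is the `hdeep` letter of
✓`AvgFunLocalLowerDensity.charge_of_deepFibrePoints` (w8-19936 g16, ✓p775703) at `L := loPrintAC (k+1)`, `ε := ε_P`, with NO size row left displayed. [cite: Balaban1985UV3, (47) p.267 + (42) p.266 + (49) p.268;
Balaban1985Averaging, Prop. 2 (52)–(54) p.26] -/
theorem hdeepLoops_loPrintAC_of_le_gamma (hγs : γ ≤ ((((4500 : ℝ) * (F.L : ℝ) ^ 5)⁻¹ / (𝔠.b₀ * Q0 𝔠.p₀)) ^ 2) ^ 2) (k : ℕ) (hk : k + 1 ≤ K) :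
    ∀ V ∈ PinnedStep.loPrintAC 𝔠.lane q.X (k + 1),
      ∃ U₀ : GaugeField (F.P K) k (Matrix.specialUnitaryGroup (Fin 2) ℂ), avgFun (expMeanLogSU (n := Fin 2)) U₀ = V ∧
        (∀ cc i, dist1 (loopHol U₀ cc i) < ((Fintype.card (Idx (F.P K)) : ℝ))⁻¹ / 10) ∧
        chiB 𝔠.lane.carrier.M₁ (rcolOf (T3Scales F γ hγ (hγ1.trans (sq_min_one_le _ 𝔠.gamma0_pos)) K) 𝔠.lane.carrier) (eps1Of (T3Scales F γ hγ (hγ1.trans (sq_min_one_le _ 𝔠.gamma0_pos)) K) 𝔠.lane.carrier) k (Hist.triv (F.P K) (k + 1)) U₀ ≠ 0 := by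
  obtain ⟨hP3, hP2, hwin, hloop⟩ := PinnedStepTrivPins.sizeRows_one_of_le_gamma (𝔠 := 𝔠) γ hγ
    (hγ1.trans (sq_min_one_le _ 𝔠.gamma0_pos)) hγs K k hk
  intro V hV
  exact q.deepFibrePoint_of_rows k hk one_pos hP3 hP2 hwin hloop V hV.1 hV.2

/-! ## §4 The lower row `Fibre57LowOnAC` at the T³ record on print's family, `hdeep`∕`hcharge` and the measurability letters discharged -/

/-- ★★★★ **THE LOWER ROW `Fibre57LowOnAC` AT THE T³ RECORD ON PRINT'S FAMILY `loPrintAC`, THE CHARGING∕DEEP-FIBRE-POINT LETTER GONE** — ✓`PinnedStepTrivPins.fibre57LowOnAC_T3_of_le_gamma_of_deepFibrePoints`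
(w8-19936 g16) at `X := q.X`, `𝔖 := q.𝔖`, `lo := PinnedStep.loPrintAC 𝔠.lane q.X`, with the record's letters discharged by name: `hav` (✓`avg_XT3_eq_avgFun`), `hU`∕`hPm`∕`hPb` (`(q.runRows.steps k hk).…`,
`cP := q.𝔄.cP k`), `hlom`∕`hlom₁` (✓`PinnedStep.measurableSet_loPrintAC` ∘ `q.measurable_UkH`), and `hdeep` (§3, hence ✓p774960's `hcharge` and ✓p774389's `hpos_ae`).  WHAT STAYS DISPLAYED at print's
family: the chart binders `Φ, J, T, hmap, hfib` (F2c's chart road), the Gaussian datum `q_1, hqm, hZ`, `hinv`, the (55)∕(58) PINS of `q.𝔖` at `triv` (`hσ hdg hstar hZU hFl`, B0), the size window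
`hγs`, and the two level-`k` family letters of print's constant `c = 1`: `hloinv` (orbit-covariance of [7]'s minimiser on `loPrintAC k`) and `hdom` («`χB_k(triv′) ≠ 0 ⇒ loPrintAC k`», (E2)).
[cite: Balaban1985UV3, (37) p.265 + (47) p.267 + (55)–(58) pp.269–270 + p.272 L32–33; Balaban1985Averaging, Prop. 2 p.26] -/
theorem fibre57LowOnAC_T3_loPrintAC_of_le_gamma (hγs : γ ≤ ((((4500 : ℝ) * (F.L : ℝ) ^ 5)⁻¹ / (𝔠.b₀ * Q0 𝔠.p₀)) ^ 2) ^ 2)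
    (k : ℕ) (hk : k + 1 ≤ K)
    (Φ : GaugeField (F.P K) (k + 1) (Matrix.specialUnitaryGroup (Fin 2) ℂ) × GaugeField (F.P K) k (Matrix.specialUnitaryGroup (Fin 2) ℂ) →
      GaugeField (F.P K) k (Matrix.specialUnitaryGroup (Fin 2) ℂ))
    (J : GaugeField (F.P K) (k + 1) (Matrix.specialUnitaryGroup (Fin 2) ℂ) × GaugeField (F.P K) k (Matrix.specialUnitaryGroup (Fin 2) ℂ) → ℝ≥0)
    (T : Set (GaugeField (F.P K) (k + 1) (Matrix.specialUnitaryGroup (Fin 2) ℂ) × GaugeField (F.P K) k (Matrix.specialUnitaryGroup (Fin 2) ℂ)))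
    (hΦ : Measurable Φ) (hJ : Measurable J) (hT : MeasurableSet T)
    (hmap : ((((fieldMeasure (F.P K) (k + 1) (Matrix.specialUnitaryGroup (Fin 2) ℂ)).prod
        (fieldMeasure (F.P K) k (Matrix.specialUnitaryGroup (Fin 2) ℂ))).restrict T).withDensity (fun z => (J z : ℝ≥0∞))).map Φ =
      (fieldMeasure (F.P K) k (Matrix.specialUnitaryGroup (Fin 2) ℂ)).restrict
        {U : GaugeField (F.P K) k (Matrix.specialUnitaryGroup (Fin 2) ℂ) |
          ∀ c i, dist1 (loopHol U c i) < ((Fintype.card (Idx (F.P K)) : ℝ))⁻¹ / 10})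
    (hfib : ∀ z ∈ T, avgFun (expMeanLogSU (n := Fin 2)) (Φ z) = z.1) (N lσ dg : ℝ)
    (q_1 : GaugeField (F.P K) (k + 1) (Matrix.specialUnitaryGroup (Fin 2) ℂ) → GaugeField (F.P K) k (Matrix.specialUnitaryGroup (Fin 2) ℂ) → ℝ)
    (hqm : ∀ V, Measurable (q_1 V)) (hZ : ∀ V, 0 < partZ (fieldMeasure (F.P K) k (Matrix.specialUnitaryGroup (Fin 2) ℂ)) (q_1 V))
    (hinv : GaugeInvariant (fun U : GaugeField (F.P K) k (Matrix.specialUnitaryGroup (Fin 2) ℂ) =>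
      Real.exp (-((towerOfAC 𝔠.lane q.X q.𝔖).mainT k (Hist.triv (F.P K) k) U) + (towerOfAC 𝔠.lane q.X q.𝔖).Pint k (Hist.triv (F.P K) k) U)))
    (hloinv : ∀ (u : GaugeTransf (F.P K) k (Matrix.specialUnitaryGroup (Fin 2) ℂ)) (U : GaugeField (F.P K) k (Matrix.specialUnitaryGroup (Fin 2) ℂ)),
      gaugeAct u U ∈ PinnedStep.loPrintAC 𝔠.lane q.X k ↔ U ∈ PinnedStep.loPrintAC 𝔠.lane q.X k)
    (hdom : ∀ U : GaugeField (F.P K) k (Matrix.specialUnitaryGroup (Fin 2) ℂ),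
      chiB 𝔠.lane.carrier.M₁ (rcolOf (T3Scales F γ hγ (hγ1.trans (sq_min_one_le _ 𝔠.gamma0_pos)) K) 𝔠.lane.carrier) (eps1Of (T3Scales F γ hγ (hγ1.trans (sq_min_one_le _ 𝔠.gamma0_pos)) K) 𝔠.lane.carrier) k (Hist.triv (F.P K) (k + 1)) U ≠ 0 → U ∈ PinnedStep.loPrintAC 𝔠.lane q.X k)
    (hσ : (piecesAC 𝔠.lane q.X q.𝔖 k).logσ₀ = lσ) (hdg : (piecesAC 𝔠.lane q.X q.𝔖 k).dg = dg)
    (hstar : (piecesAC 𝔠.lane q.X q.𝔖 k).starB (Hist.triv (F.P K) (k + 1)) = N)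
    (hZU : ∀ V, (piecesAC 𝔠.lane q.X q.𝔖 k).logZU (Hist.triv (F.P K) (k + 1)) V =
      Real.log (partZ (fieldMeasure (F.P K) k (Matrix.specialUnitaryGroup (Fin 2) ℂ)) (q_1 V)))
    (hFl : ∀ V, (piecesAC 𝔠.lane q.X q.𝔖 k).logFl (Hist.triv (F.P K) (k + 1)) V =
      Real.log (∫ U', (Real.exp (-((lσ + dg * Real.log ((T3Scales F γ hγ (hγ1.trans (sq_min_one_le _ 𝔠.gamma0_pos)) K).gk k)) * N)) * T.indicator (fun z => (J z : ℝ)) (V, U')) *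
              chiB 𝔠.lane.carrier.M₁ (rcolOf (T3Scales F γ hγ (hγ1.trans (sq_min_one_le _ 𝔠.gamma0_pos)) K) 𝔠.lane.carrier) (eps1Of (T3Scales F γ hγ (hγ1.trans (sq_min_one_le _ 𝔠.gamma0_pos)) K) 𝔠.lane.carrier) k
                (Hist.triv (F.P K) (k + 1)) (Φ (V, U')) *
              Real.exp (-((towerOfAC 𝔠.lane q.X q.𝔖).mainT k (Hist.triv (F.P K) k) (Φ (V, U')) -
                    (towerOfAC 𝔠.lane q.X q.𝔖).mainT (k + 1) (Hist.triv (F.P K) (k + 1)) V)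
                + ((towerOfAC 𝔠.lane q.X q.𝔖).Pint k (Hist.triv (F.P K) k) (Φ (V, U')) - (piecesAC 𝔠.lane q.X q.𝔖 k).Pold (Hist.triv (F.P K) (k + 1)) V)
                + q_1 V U')
            ∂(normalized (fieldMeasure (F.P K) k (Matrix.specialUnitaryGroup (Fin 2) ℂ)) (q_1 V)))) :
    Fibre57LowOnAC 𝔠.lane q.X q.𝔖 (PinnedStep.loPrintAC 𝔠.lane q.X) k := by
  have hkK : k ≤ K := by omega
  have hkm : k + 1 ≤ F.m + K := by omega
  exact PinnedStepTrivPins.fibre57LowOnAC_T3_of_le_gamma_of_deepFibrePoints 𝔠 q.X q.𝔖 hγs (PinnedStep.loPrintAC 𝔠.lane q.X) k hkK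
    (PinnedStepTrivPins.avg_XT3_eq_avgFun F γ hγ _ K q.reg q.Uk q.UkH q.hU0 q.hUs hkm)
    Φ J T hΦ hJ hT hmap hfib N lσ dg q_1 hqm hZ
    ((q.runRows.steps k hk).hU _) ((q.runRows.steps k hk).hPm _) (q.𝔄.cP k) ((q.runRows.steps k hk).hPb _)
    hinv (PinnedStep.measurableSet_loPrintAC 𝔠.lane q.X k ((q.runRows.steps k hk).hU _)) hloinv hdom
    hσ hdg hstar hZU hFl (PinnedStep.measurableSet_loPrintAC 𝔠.lane q.X (k + 1) (q.measurable_UkH (k + 1) hk _))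
    (q.hdeep_loPrintAC_of_le_gamma hγs k hk)

end AlphaInputsT3AC.PkgCoreRows

end Summit.QuantumFields.YangMills.Theorems

end
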